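import Mathlib
import Summits.ValiantsHypothesis.ValiantsHypothesis.Theses.ProofCarryingSymmetry
import Summits.ValiantsHypothesis.ValiantsHypothesis.Theorems.ProofCarryingSymmetryRestorationQPACHeight

/-!
# Route ProofCarryingSymmetry — crux `RestorationQP`, line `registered`: inducing symmetric circuits from a finite-index subgroup

Support file for the crux item `stmt-ValiantsHypothesis-10343` (lead c4, cycle 4).  Third component
of the coset-covering mechanism for the graded stability statements S3^(t) of the bet (with the
Neumann engine `exists_index_le_of_saturation_cover`, p166697, and the open Church–Rosser statement
for `t` ground distributivity instances): SYMMETRISATION OVER COSETS.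

`CosetInduction.exists_isSymmetric_induced`: if a labelled arithmetic circuit `D` over a field `K`
is symmetric under a subgroup `H ≤ Γ` of a finite group `Γ` acting on the variables, computes a
`Γ`-INVARIANT polynomial `p`, and the index `[Γ : H]` is invertible in `K`, then a `Γ`-symmetric
circuit with at most `|X| + [Γ:H]·|D| + |D| + 3` gates computes `p`.

Construction (`CosetInduction.circuit`): shared input gates (one per variable in `X`, one per
constant of `D` and the constant `u = [Γ:H]⁻¹`); for every left coset `q = rH` (representative
`r = q.out`) a BLOCK `{q} × D` in which the gate `(q, g)` keeps the label and the wires of `g`,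
except that an input gate of `D` labelled `x` (resp. `c`) becomes a unary `+` RELAY gate wired to the
shared input `r • x` (resp. `c`) — so block `q` computes `r • Ĝ` gate by gate (`eval_block`); a `+`
gate summing the `[Γ:H]` block outputs (value `[Γ:H] · p` by invariance) and the output gate
`× u`.  Symmetry (`circuit_isSymmetric`): `γ ∈ Γ` permutes the cosets, `γ r_q = r_{γq} h` with
`h = r_{γq}⁻¹ γ r_q ∈ H`, and block `q` is carried to block `γq` by an automorphism of `D` extending
`h` (`Equiv.prodShear`); the relays match because `r_{γq} • (h • x) = γ • (r_q • x)`.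
Folklore (induced representations / Dawar–Wilsenach's remark that symmetric circuits are closed
under the natural operations); everything proved, no named facts.
-/

-- single-problem summit: `Summit.ValiantsHypothesis.ValiantsHypothesis.…` is the namespace by design (D-0017)
set_option linter.dupNamespace false

noncomputable section

open scoped Classical Pointwise

namespace Summit.ValiantsHypothesis.ValiantsHypothesis.Theorems

namespace CosetInduction

open Literature.Computability.AlgebraicComplexity MvPolynomial

universe u v w z

variable {K : Type u} {X : Type v} {Γ : Type w} {G₀ : Type z}

/-! ### Shared constants -/

/-- The constant labelling a gate, if any. [folklore] -/
def constOf (l : CircuitLabel K X) : Finset K :=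
  match l with
  | .const c => {c}
  | _ => ∅

/-- A label carries at most one constant. [folklore] -/
theorem card_constOf_le (l : CircuitLabel K X) : (constOf l).card ≤ 1 := by
  unfold constOf
  split <;> simp

/-- The constants labelling gates of `D`, together with the normalising constant `u`. [folklore] -/
def consts [Fintype G₀] (D : LabelledArithCircuit K X Unit G₀) (u : K) : Finset K :=
  insert u (Finset.univ.biUnion fun g => constOf (D.label g))

/-- The normalising constant is one of the shared constants. [folklore] -/
theorem mem_consts_self [Fintype G₀] (D : LabelledArithCircuit K X Unit G₀) (u : K) :
    u ∈ consts D u :=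
  Finset.mem_insert_self _ _

/-- Every constant labelling a gate of `D` is a shared constant. [folklore] -/
theorem mem_consts_of_label [Fintype G₀] (D : LabelledArithCircuit K X Unit G₀) (u : K)
    {g : G₀} {c : K} (h : D.label g = .const c) : c ∈ consts D u := by
  refine Finset.mem_insert_of_mem (Finset.mem_biUnion.2 ⟨g, Finset.mem_univ _, ?_⟩)
  rw [h]
  exact Finset.mem_singleton_self _

/-- There are at most `|D| + 1` shared constants. [folklore] -/
theorem card_consts_le [Fintype G₀] (D : LabelledArithCircuit K X Unit G₀) (u : K) :
    (consts D u).card ≤ Fintype.card G₀ + 1 := by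
  unfold consts
  refine (Finset.card_insert_le _ _).trans (Nat.add_le_add_right ?_ 1)
  refine Finset.card_biUnion_le.trans ?_
  calc ∑ g : G₀, (constOf (D.label g)).card ≤ ∑ _g : G₀, 1 :=
        Finset.sum_le_sum fun g _ => card_constOf_le (D.label g)
    _ = Fintype.card G₀ := by simp

/-! ### Gates, wires, labels -/

/-- The gate type: shared inputs (variables and constants), the blocks `(Γ ⧸ H) × G₀`, and two top
gates (`false` = the sum of the block outputs, `true` = the normalised output). [folklore] -/
abbrev Gate [Group Γ] [Fintype G₀] (H : Subgroup Γ) (D : LabelledArithCircuit K X Unit G₀) (u : K) :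
    Type (max v u w z) :=
  ((X ⊕ ↥(consts D u)) ⊕ ((Γ ⧸ H) × G₀)) ⊕ Bool

/-- The shared input gate a label points to. [folklore] -/
def inputTarget [Fintype G₀] (D : LabelledArithCircuit K X Unit G₀) (u : K) :
    CircuitLabel K X → Option (X ⊕ ↥(consts D u))
  | .var x => some (.inl x)
  | .const c => if h : c ∈ consts D u then some (.inr ⟨c, h⟩) else none
  | .add => none
  | .mul => none

/-- `inputTarget` is equivariant: twisting the label by `γ` moves the variable target by `γ`. [folklore] -/
theorem inputTarget_smul [Group Γ] [MulAction Γ X] [Fintype G₀] (D : LabelledArithCircuit K X Unit G₀)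
    (u : K) (γ : Γ) (l : CircuitLabel K X) :
    inputTarget D u (γ • l) = (inputTarget D u l).map (Sum.map (fun x => γ • x) id) := by
  cases l with
  | var x => rfl
  | const c =>
    simp only [CircuitLabel.smul_const, inputTarget]
    split_ifs <;> rfl
  | add => rfl
  | mul => rfl

/-- A label has no input target iff it is not an input label (all its constants being shared). [folklore] -/
theorem inputTarget_eq_none_iff [Fintype G₀] (D : LabelledArithCircuit K X Unit G₀) (u : K)
    (l : CircuitLabel K X) (hl : ∀ c, l = .const c → c ∈ consts D u) :
    inputTarget D u l = none ↔ ¬ l.IsInput := by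
  cases l with
  | var x => simp [inputTarget]
  | const c => simp [inputTarget, hl c rfl]
  | add => simp [inputTarget]
  | mul => simp [inputTarget]

/-- The coset representative. [folklore] -/
def rep [Group Γ] (H : Subgroup Γ) (q : Γ ⧸ H) : Γ := Quotient.out q

/-- The representative represents its coset. [folklore] -/
theorem mk_rep [Group Γ] (H : Subgroup Γ) (q : Γ ⧸ H) : (QuotientGroup.mk (rep H q) : Γ ⧸ H) = q :=
  QuotientGroup.out_eq' q

/-- Every constant that a twisted label of a gate of `D` can carry lies in `consts`. [folklore] -/
theorem consts_of_smul_label [Group Γ] [MulAction Γ X] [Fintype G₀] (D : LabelledArithCircuit K X Unit G₀)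
    (u : K) (γ : Γ) (g : G₀) : ∀ c, γ • D.label g = .const c → c ∈ consts D u := by
  intro c hc
  cases hg : D.label g with
  | var x => rw [hg] at hc; simp at hc
  | const c' =>
    rw [hg] at hc
    simp only [CircuitLabel.smul_const, CircuitLabel.const.injEq] at hc
    subst hc
    exact mem_consts_of_label D u hg
  | add => rw [hg] at hc; simp at hc
  | mul => rw [hg] at hc; simp at hc

section Construction

variable [Group Γ] [MulAction Γ X] [Fintype Γ] [Fintype G₀]
  (H : Subgroup Γ) (D : LabelledArithCircuit K X Unit G₀) (u : K)

/-- The embedding of block `q`. [folklore] -/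
def blockEmb (q : Γ ⧸ H) : G₀ ↪ Gate H D u :=
  ⟨fun g => .inl (.inr (q, g)), fun a b hab => by simpa using hab⟩

/-- The embedding of the block outputs. [folklore] -/
def outEmb : (Γ ⧸ H) ↪ Gate H D u :=
  ⟨fun q => .inl (.inr (q, D.output ())), fun a b hab => by simpa using hab⟩

/-- Wires. [folklore] -/
def wires : Gate H D u → Finset (Gate H D u)
  | .inl (.inl _) => ∅
  | .inl (.inr (q, g)) =>
    match inputTarget D u (rep H q • D.label g) with
    | some t => {Sum.inl (Sum.inl t)}
    | none => (D.children g).map (blockEmb H D u q)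
  | .inr false => (Finset.univ : Finset (Γ ⧸ H)).map (outEmb H D u)
  | .inr true => {Sum.inr false, Sum.inl (Sum.inl (Sum.inr ⟨u, mem_consts_self D u⟩))}

omit [MulAction Γ X] [Fintype Γ] in
/-- Labels. [folklore] -/
def labels : Gate H D u → CircuitLabel K X
  | .inl (.inl (.inl x)) => .var x
  | .inl (.inl (.inr c)) => .const c.1
  | .inl (.inr (_, g)) => if (D.label g).IsInput then .add else D.label g
  | .inr false => .add
  | .inr true => .mul

omit [MulAction Γ X] [Fintype Γ] in
/-- Block gates are never input gates (inputs of `D` become relays). [folklore] -/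
theorem labels_block_not_isInput (q : Γ ⧸ H) (g : G₀) :
    ¬ (labels H D u (.inl (.inr (q, g)))).IsInput := by
  simp only [labels]
  split_ifs with h
  · simp
  · exact h

/-! ### Well-foundedness -/

omit [MulAction Γ X] [Fintype Γ] in
/-- A rank function strictly increasing along wires. [folklore] -/
def rank : Gate H D u → ℕ
  | .inl (.inl _) => 0
  | .inl (.inr (_, g)) => ACStability.height D g + 1
  | .inr false => Fintype.card G₀ + 1
  | .inr true => Fintype.card G₀ + 2

/-- The rank strictly increases along wires. [folklore] -/
theorem rank_lt_of_mem_wires {s t : Gate H D u} (h : s ∈ wires H D u t) :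
    rank H D u s < rank H D u t := by
  rcases t with ((_ | ⟨q, g⟩) | (_ | _))
  · simp [wires] at h
  · simp only [wires] at h
    split at h
    · rw [Finset.mem_singleton] at h
      subst h
      simp [rank]
    · rw [Finset.mem_map] at h
      obtain ⟨g', hg', rfl⟩ := h
      simp only [blockEmb, Function.Embedding.coeFn_mk, rank]
      exact Nat.succ_lt_succ (ACStability.height_lt_of_mem_children D hg')
  · simp only [wires, Finset.mem_map] at h
    obtain ⟨q, -, rfl⟩ := h
    show ACStability.height D (D.output ()) + 1 < Fintype.card G₀ + 1
    exact Nat.succ_lt_succ (ACStability.height_lt_card D _)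
  · simp only [wires, Finset.mem_insert, Finset.mem_singleton] at h
    rcases h with rfl | rfl <;> simp [rank]

/-- The wire relation is well founded. [folklore] -/
theorem wires_wf : WellFounded fun s t : Gate H D u => s ∈ wires H D u t :=
  Subrelation.wf (fun h => rank_lt_of_mem_wires H D u h) (InvImage.wf (rank H D u) Nat.lt_wfRel.wf)

/-! ### The circuit axioms -/

/-- The wires of a relay gate: the single shared input its twisted label points to. [folklore] -/
theorem wires_block_of_isInput (q : Γ ⧸ H) {g : G₀} (hin : (D.label g).IsInput) :
    ∃ t, inputTarget D u (rep H q • D.label g) = some t ∧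
      wires H D u (.inl (.inr (q, g))) = {Sum.inl (Sum.inl t)} := by
  have hne : inputTarget D u (rep H q • D.label g) ≠ none := by
    rw [Ne, inputTarget_eq_none_iff D u _ (consts_of_smul_label D u (rep H q) g),
      CircuitLabel.isInput_smul]
    exact not_not.2 hin
  obtain ⟨t, ht⟩ := Option.ne_none_iff_exists'.1 hne
  refine ⟨t, ht, ?_⟩
  simp only [wires]
  rw [ht]

/-- The wires of an internal block gate: the block copies of the wires of `D`. [folklore] -/
theorem wires_block_of_not_isInput (q : Γ ⧸ H) {g : G₀} (hin : ¬ (D.label g).IsInput) :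
    wires H D u (.inl (.inr (q, g))) = (D.children g).map (blockEmb H D u q) := by
  have hnone : inputTarget D u (rep H q • D.label g) = none := by
    rw [inputTarget_eq_none_iff D u _ (consts_of_smul_label D u (rep H q) g),
      CircuitLabel.isInput_smul]
    exact hin
  simp only [wires]
  rw [hnone]

/-- Def. 2.2: exactly the gates with an input label have no wires. [folklore] -/
theorem labels_isInput_iff (s : Gate H D u) : (labels H D u s).IsInput ↔ wires H D u s = ∅ := by
  rcases s with ((x | c) | ⟨q, g⟩) | (_ | _)
  · simp [labels, wires]
  · simp [labels, wires]
  · refine iff_of_false (labels_block_not_isInput H D u q g) ?_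
    by_cases hin : (D.label g).IsInput
    · obtain ⟨t, -, hw⟩ := wires_block_of_isInput H D u q hin
      rw [hw]
      exact Finset.singleton_ne_empty _
    · rw [wires_block_of_not_isInput H D u q hin]
      simp only [Finset.map_eq_empty]
      rw [← D.isInput_iff]
      exact hin
  · simp only [labels, wires, CircuitLabel.not_isInput_add, false_iff, Finset.map_eq_empty,
      Finset.univ_eq_empty_iff, not_isEmpty_iff]
    exact ⟨(QuotientGroup.mk 1 : Γ ⧸ H)⟩
  · simp [labels, wires]

omit [MulAction Γ X] [Fintype Γ] in
/-- Def. 2.2: distinct input gates have distinct labels. [folklore] -/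
theorem labels_eq_of_eq (s t : Gate H D u) (hs : (labels H D u s).IsInput)
    (hst : labels H D u s = labels H D u t) : s = t := by
  rcases s with ((x | c) | ⟨q, g⟩) | (_ | _)
  · rcases t with ((x' | c') | ⟨q', g'⟩) | (_ | _)
    · simp only [labels, CircuitLabel.var.injEq] at hst
      rw [hst]
    · simp [labels] at hst
    · exfalso
      have h := labels_block_not_isInput H D u q' g'
      rw [← hst] at h
      exact h (by simp [labels])
    · simp [labels] at hst
    · simp [labels] at hst
  · rcases t with ((x' | c') | ⟨q', g'⟩) | (_ | _)
    · simp [labels] at hst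
    · simp only [labels, CircuitLabel.const.injEq] at hst
      rw [Subtype.ext hst]
    · exfalso
      have h := labels_block_not_isInput H D u q' g'
      rw [← hst] at h
      exact h (by simp [labels])
    · simp [labels] at hst
    · simp [labels] at hst
  · exact absurd hs (labels_block_not_isInput H D u q g)
  · simp [labels] at hs
  · simp [labels] at hs

/-- **The induced circuit.** [folklore] -/
def circuit : LabelledArithCircuit K X Unit (Gate H D u) where
  children := wires H D u
  label := labels H D u
  output := fun _ => .inr true
  wf := wires_wf H D u
  isInput_iff := labels_isInput_iff H D u
  eq_of_label_eq := labels_eq_of_eq H D u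
  output_injective := fun _ _ _ => Subsingleton.elim _ _

/-- The labels of the induced circuit. [folklore] -/
@[simp] theorem circuit_label : (circuit H D u).label = labels H D u := rfl

/-- The wires of the induced circuit. [folklore] -/
@[simp] theorem circuit_children : (circuit H D u).children = wires H D u := rfl

/-- The output gate of the induced circuit. [folklore] -/
@[simp] theorem circuit_output (y : Unit) : (circuit H D u).output y = .inr true := rfl

end Construction

end CosetInduction

open Literature.Computability.AlgebraicComplexity in
/-- **Well-formedness summary of the induced circuit** (the registered helper statement of this
file): in `CosetInduction.circuit` exactly the gates with an input label have no wires.  The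
evaluation, the symmetry and the size bound are in the sequel file
`…RestorationQPCosetInductionSymmetric`. [folklore] -/
theorem cosetInduction_isInput_iff : ∀ {K : Type} {X : Type} {Γ : Type} [Group Γ] [MulAction Γ X] [Fintype Γ] (H : Subgroup Γ) {G₀ : Type} [Fintype G₀] (D : LabelledArithCircuit K X Unit G₀) (u : K) (s : CosetInduction.Gate H D u), (CosetInduction.labels H D u s).IsInput ↔ CosetInduction.wires H D u s = ∅ :=
  fun H _ _ D u s => CosetInduction.labels_isInput_iff H D u s

end Summit.ValiantsHypothesis.ValiantsHypothesis.Theorems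

end
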